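import Summits.RiemannHypothesis.RiemannHypothesis.Theorems.WeilFormatCPolyWindowArch
import Summits.RiemannHypothesis.RiemannHypothesis.Theorems.WeilFormatCWindowGram
import HarnessLib

/-!
# Format C, design C∞ (L2–IV): the window form of two polynomial windows in closed form (the profile × profile entries)

Route context: Fourier–Galerkin / Schur-complement certificates of Weil positivity on a window ("format C";
cell memo `run/shared/lean/pub/rh-explicit/rh-explicit-weil-10/FORMATC-DESIGN.md` §9.12.7–§9.12.11, KERNEL-LEVER.md §11–§13;
supporting stmt-RiemannHypothesis-0098; seat rh-explicit-weil-10).  Assembles `WeilFormatCPolyWindow{Increment,Pole,Arch}.lean`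
(the three pieces of `weilWindowSesq a u v = P(u,v) + 𝓔_a(u,v) − M_a ∫ u conj v`, `WeilFormatCDefs.weilWindowSesq_eq`) on
monomial windows `1x^j := x^j·1_{[−a,a]}`:

* **`weilWindowSesq_indicator_pow`** — for `a > 0` the entry `W_a(1x^j, 1x^k)` is the REAL number
  `POLE_{jk} + PRIME_{jk} + ARCH_{jk} − M_a·m_{j+k}` with
  `POLE_{jk} = 2C_jC_k − 2S_jS_k` (`C_j = ∫_{−a}^{a} x^j cosh(x/2)`, `S_j = ∫_{−a}^{a} x^j sinh(x/2)`; closed forms in `…Pole.lean`),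
  `PRIME_{jk} = Σ_{log n<2a} Λ(n) n^{-1/2} K_{jk}(log n)`, `ARCH_{jk} = ∫_{(0,2a]} ρ K_{jk} + 2 m_{j+k} ∫_{(2a,∞)} ρ`
  (`K_{jk}` the window-scale increment polynomial of `…Increment.lean`, `ρ = e^{t/2}/(2 sinh t)`),
  `m_n = (a^{n+1} − (−a)^{n+1})/(n+1)`, `M_a = weilMarkovConstant a`; in particular its imaginary part vanishes;
* `indicator_sum_mul_pow` / **`weilWindowSesq_indicator_poly`** — a polynomial window `1·(Σ_j c_j x^j)` is the combination
  `Σ_j c_j • 1x^j`, so by sesquilinearity (`weilWindowSesq_sum_left/right`) the entry of two polynomial windows is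
  `Σ_j Σ_k c_j conj(d_k) W_a(1x^j, 1x^k)` — the C∞ deflation profiles (even `(a²−x²)²x^{2i}`, odd `(a²−x²)x^{2i+1}`, or any other
  basis of the window polynomials) are thereby evaluated from the monomial table.

The (polynomial window, `χ_m`) entries follow in a sibling file.  Pure calculus; standard axioms; no RH claim.
-/

set_option autoImplicit false
-- `Summit.RiemannHypothesis.RiemannHypothesis.…` is the layout-mandated namespace (summit = problem name).
set_option linter.dupNamespace false

noncomputable section

open Complex Filter Set MeasureTheory
open scoped Real Topology ComplexConjugate ArithmeticFunction.vonMangoldt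

namespace Summit.RiemannHypothesis.RiemannHypothesis.Theorems.WeilFormatC

open Literature.NumberTheory.LFunctions

variable {a : ℝ}

/-! ## The monomial entries -/

/-- **The window form of two monomial windows in closed form** (`a > 0`): `weilWindowSesq a (1x^j) (1x^k)` is the cast of
the real number `POLE_{jk} + (PRIME_{jk} + ARCH_{jk}) − M_a m_{j+k}` described in the module docstring. -/
theorem weilWindowSesq_indicator_pow (ha : 0 < a) (j k : ℕ) :
    weilWindowSesq a ((Icc (-a) a).indicator fun x : ℝ ↦ ((x : ℂ)) ^ j)
        ((Icc (-a) a).indicator fun x : ℝ ↦ ((x : ℂ)) ^ k) =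
      (((2 * (∫ x in (-a)..a, x ^ j * Real.cosh (x / 2)) * (∫ x in (-a)..a, x ^ k * Real.cosh (x / 2)) -
          2 * (∫ x in (-a)..a, x ^ j * Real.sinh (x / 2)) * (∫ x in (-a)..a, x ^ k * Real.sinh (x / 2)))
        + ((∑ n ∈ weilPrimeIndex a, (Λ n : ℝ) / Real.sqrt n *
            (2 * ((a ^ (j + k + 1) - (-a) ^ (j + k + 1)) / (j + k + 1))
              - (∑ i ∈ Finset.range (j + 1), (j.choose i : ℝ) * Real.log n ^ (j - i) *
                  (((a - Real.log n) ^ (i + k + 1) - (-a) ^ (i + k + 1)) / (i + k + 1)))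
              - (∑ i ∈ Finset.range (k + 1), (k.choose i : ℝ) * Real.log n ^ (k - i) *
                  (((a - Real.log n) ^ (i + j + 1) - (-a) ^ (i + j + 1)) / (i + j + 1)))))
          + ((∫ t in Ioc 0 (2 * a), weilArchDensity t *
              (2 * ((a ^ (j + k + 1) - (-a) ^ (j + k + 1)) / (j + k + 1))
                - (∑ i ∈ Finset.range (j + 1), (j.choose i : ℝ) * t ^ (j - i) *
                    (((a - t) ^ (i + k + 1) - (-a) ^ (i + k + 1)) / (i + k + 1)))
                - (∑ i ∈ Finset.range (k + 1), (k.choose i : ℝ) * t ^ (k - i) *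
                    (((a - t) ^ (i + j + 1) - (-a) ^ (i + j + 1)) / (i + j + 1)))))
            + 2 * ((a ^ (j + k + 1) - (-a) ^ (j + k + 1)) / (j + k + 1)) * ∫ t in Ioi (2 * a), weilArchDensity t))
        - weilMarkovConstant a * ((a ^ (j + k + 1) - (-a) ^ (j + k + 1)) / (j + k + 1)) : ℝ) : ℂ) := by
  rw [weilWindowSesq_eq, weilPoleSesq_indicator_pow ha.le, sum_prime_weilIncrementSesq_indicator_pow,
    setIntegral_weilArchDensity_mul_weilIncrementSesq_indicator_pow ha, integral_indicator_pow_mul_conj_indicator_pow ha.le]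
  push_cast
  ring

/-- The monomial entries are real: `Im weilWindowSesq a (1x^j) (1x^k) = 0` (`a > 0`). -/
theorem weilWindowSesq_indicator_pow_im (ha : 0 < a) (j k : ℕ) :
    (weilWindowSesq a ((Icc (-a) a).indicator fun x : ℝ ↦ ((x : ℂ)) ^ j)
        ((Icc (-a) a).indicator fun x : ℝ ↦ ((x : ℂ)) ^ k)).im = 0 := by
  rw [weilWindowSesq_indicator_pow ha, Complex.ofReal_im]

/-- The monomial entries are symmetric: `W_a(1x^k, 1x^j) = W_a(1x^j, 1x^k)` (hermitian symmetry of a real entry; `a > 0`). -/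
theorem weilWindowSesq_indicator_pow_symm (ha : 0 < a) (j k : ℕ) :
    weilWindowSesq a ((Icc (-a) a).indicator fun x : ℝ ↦ ((x : ℂ)) ^ k)
        ((Icc (-a) a).indicator fun x : ℝ ↦ ((x : ℂ)) ^ j) =
      weilWindowSesq a ((Icc (-a) a).indicator fun x : ℝ ↦ ((x : ℂ)) ^ j)
        ((Icc (-a) a).indicator fun x : ℝ ↦ ((x : ℂ)) ^ k) := by
  rw [weilWindowSesq_conj_symm, weilWindowSesq_indicator_pow ha, Complex.conj_ofReal]

/-! ## Polynomial windows through the monomial table -/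

/-- A polynomial window is the linear combination of the monomial windows:
`1_{[−a,a]}·(Σ_{j∈s} c_j x^j) = Σ_{j∈s} c_j • 1x^j`. -/
theorem indicator_sum_mul_pow (a : ℝ) (s : Finset ℕ) (c : ℕ → ℂ) :
    (Icc (-a) a).indicator (fun x : ℝ ↦ ∑ j ∈ s, c j * ((x : ℂ)) ^ j) =
      ∑ j ∈ s, c j • (Icc (-a) a).indicator (fun x : ℝ ↦ ((x : ℂ)) ^ j) := by
  funext x
  rw [Finset.sum_apply]
  by_cases hx : x ∈ Icc (-a) a
  · simp only [indicator_of_mem hx, Pi.smul_apply, smul_eq_mul]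
  · simp only [indicator_of_notMem hx, Pi.smul_apply, smul_eq_mul, mul_zero, Finset.sum_const_zero]

/-- A polynomial window is a window function. -/
theorem isWindowFunction_indicator_poly (a : ℝ) (s : Finset ℕ) (c : ℕ → ℂ) :
    IsWindowFunction a ((Icc (-a) a).indicator fun x : ℝ ↦ ∑ j ∈ s, c j * ((x : ℂ)) ^ j) := by
  rw [indicator_sum_mul_pow]
  exact IsWindowFunction.sum s c fun j _ ↦ isWindowFunction_indicator_pow a j

/-- **The window form of two polynomial windows through the monomial table** (`a > 0`):
`W_a(1·Σ_j c_j x^j, 1·Σ_k d_k x^k) = Σ_j Σ_k c_j conj(d_k) W_a(1x^j, 1x^k)`, each monomial entry being the real closed form of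
`weilWindowSesq_indicator_pow`. -/
theorem weilWindowSesq_indicator_poly (ha : 0 < a) (s s' : Finset ℕ) (c d : ℕ → ℂ) :
    weilWindowSesq a ((Icc (-a) a).indicator fun x : ℝ ↦ ∑ j ∈ s, c j * ((x : ℂ)) ^ j)
        ((Icc (-a) a).indicator fun x : ℝ ↦ ∑ k ∈ s', d k * ((x : ℂ)) ^ k) =
      ∑ j ∈ s, ∑ k ∈ s', c j * conj (d k) *
        weilWindowSesq a ((Icc (-a) a).indicator fun x : ℝ ↦ ((x : ℂ)) ^ j)
          ((Icc (-a) a).indicator fun x : ℝ ↦ ((x : ℂ)) ^ k) := by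
  rw [indicator_sum_mul_pow, indicator_sum_mul_pow,
    weilWindowSesq_sum_left ha.le s (fun j _ ↦ isWindowFunction_indicator_pow a j)
      (IsWindowFunction.sum s' d fun k _ ↦ isWindowFunction_indicator_pow a k) c a]
  refine Finset.sum_congr rfl fun j _ ↦ ?_
  rw [weilWindowSesq_sum_right ha.le s' (fun k _ ↦ isWindowFunction_indicator_pow a k)
    (isWindowFunction_indicator_pow a j) d a, Finset.mul_sum]
  exact Finset.sum_congr rfl fun k _ ↦ by ring

/-- **Real-coefficient polynomial windows have real entries**: for real coefficient vectors `c, d` the entry is the real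
double sum `Σ_j Σ_k c_j d_k · W_a(1x^j, 1x^k)` (the C∞ deflation profiles are real polynomials). -/
theorem weilWindowSesq_indicator_poly_real (ha : 0 < a) (s s' : Finset ℕ) (c d : ℕ → ℝ) :
    weilWindowSesq a ((Icc (-a) a).indicator fun x : ℝ ↦ ∑ j ∈ s, (c j : ℂ) * ((x : ℂ)) ^ j)
        ((Icc (-a) a).indicator fun x : ℝ ↦ ∑ k ∈ s', (d k : ℂ) * ((x : ℂ)) ^ k) =
      ((∑ j ∈ s, ∑ k ∈ s', c j * d k *
        (weilWindowSesq a ((Icc (-a) a).indicator fun x : ℝ ↦ ((x : ℂ)) ^ j)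
          ((Icc (-a) a).indicator fun x : ℝ ↦ ((x : ℂ)) ^ k)).re : ℝ) : ℂ) := by
  rw [weilWindowSesq_indicator_poly ha s s' (fun j ↦ (c j : ℂ)) (fun k ↦ (d k : ℂ))]
  push_cast
  refine Finset.sum_congr rfl fun j _ ↦ Finset.sum_congr rfl fun k _ ↦ ?_
  rw [Complex.conj_ofReal, weilWindowSesq_indicator_pow ha, Complex.ofReal_re]

end Summit.RiemannHypothesis.RiemannHypothesis.Theorems.WeilFormatC

end
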